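import Summits.CriticalPhenomena.PercolationContinuityZ3.Theorems.PercNearOneGluingNoHeavyPcintNawFreeZ6F10Defs1
import Summits.CriticalPhenomena.PercolationContinuityZ3.Theorems.PercNearOneGluingNoHeavyPcintNawFreeZ6F10Defs2
import Summits.CriticalPhenomena.PercolationContinuityZ3.Theorems.PercNearOneGluingNoHeavyPcintNawRandMemKernelSymTab
import HarnessLib

/-!
# PCINT lane, kernel reduced-state B2d (`nawfree`) certificate `Z6F10` (d = 6, memory τ = 10, delay kt = 4, 798 state classes): table root, symmetry table, parameters

Cell `prim-pcint`, seat `prim-pcint-1` (gen 6); memo `run/shared/lean/prim/pcint/REDUCTIONS.md` §B2d (delayed chain payments with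
free-neighbour shares).  Does NOT build on p205010.  Data for `NawK.le_siteCriticalProb_of_checkRowsF` (`…PcintNawFreeMemKernelCert`):
`p = 10110/100000`, weight table `Q_k/100000`, `Q = [89890, 89890, 94811, 96510, 97371, 97891, 98240, 98489, 98677, 98823, 98940, 99036, 99116]` (`Q_k^k·100000 ≥ (100000-10110)·100000^k`, nondecreasing), `λ = 99999/100000`; Collatz–Wielandt
weights (scale 10⁹) from a power iteration, exact off-line max row ratio 0.9998424171 < λ.  Generated by work/gen6/gen_free.py
(pcint-1 gen 6 folder); the kernel re-checks every row.
-/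

noncomputable section

namespace Summit.CriticalPhenomena.PercolationContinuityZ3.Theorems.Pcint

namespace NawFreeZ6F10

set_option maxRecDepth 8000 in
/-- The certificate table (search tree keyed by row index). [folklore] -/
def tree : NawK.NT := (NawK.NT.node t_0_399 399 (689689618, [([-1,-1,-2,-1,0,0], 5), ([-1,-1,-2,0,0,0], 4), ([-1,-1,-1,0,0,0], 3), ([-1,-1,0,0,0,0], 2), ([-1,0,-2,-1,0,0], 6), ([-1,0,-1,-1,0,0], 7), ([-1,0,0,0,0,0], 1)], [some (38, 0), none, some (39, 2), none, some (40, 4), some (662, 5), some (42, 6), some (663, 7), some (42, 8), some (42, 9), some (42, 10), some (42, 11)]) t_400_798)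

/-- The 12 signed permutations of `ℤ^6` used by the certificate, as tables. [folklore] -/
def syms : List (List (ℕ × Bool)) := [[(0, true), (1, true), (2, true), (3, true), (4, true), (5, true)], [(0, false), (1, true), (2, true), (3, true), (4, true), (5, true)], [(1, true), (0, true), (2, true), (3, true), (4, true), (5, true)], [(1, true), (0, false), (2, true), (3, true), (4, true), (5, true)], [(1, true), (2, true), (0, true), (3, true), (4, true), (5, true)], [(1, true), (2, true), (0, false), (3, true), (4, true), (5, true)], [(1, true), (2, true), (3, true), (0, true), (4, true), (5, true)], [(1, true), (2, true), (3, true), (0, false), (4, true), (5, true)], [(1, true), (2, true), (3, true), (4, true), (0, true), (5, true)], [(1, true), (2, true), (3, true), (4, true), (0, false), (5, true)], [(1, true), (2, true), (3, true), (4, true), (5, true), (0, true)], [(1, true), (2, true), (3, true), (4, true), (5, true), (0, false)]]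

/-- Every table is a valid signed permutation table. [folklore] -/
theorem syms_valid : syms.all (NawK.validTab 6) = true := by decide +kernel

/-- The weight table (numerators over the denominator). [folklore] -/
def QL : List ℕ := [89890, 89890, 94811, 96510, 97371, 97891, 98240, 98489, 98677, 98823, 98940, 99036, 99116]

/-- The row check of this certificate. [folklore] -/
def chk (i : ℕ) : Bool := NawK.checkRowF 10 4 6 798 10110 100000 99999 100000 QL syms tree i

end NawFreeZ6F10

end Summit.CriticalPhenomena.PercolationContinuityZ3.Theorems.Pcint
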